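import Mathlib
import Literature.AlgebraicGeometry.Resolution.BlowupChartMembership
import Literature.AlgebraicGeometry.Resolution.MarkedIdealsEtale
import Summits.ResolutionOfSingularities.ResolutionOfSingularities.Theorems.RadicialJungCleanModelsCleanProp44ChartStalk
import HarnessLib

/-!
# Route `RadicialJung`, crux `CleanModels` (stmt-ResolutionOfSingularities-15917), line `Sketch` rev 35, stub 6 `stub_cleanProp44` (X44c):
# THE CHART IDENTIFICATION (census (S2)) — THE σ-TOWER STOREY `n = 2` READY TO CHAIN: blowing up the σ-curve `Z = V(t, v)` at a point of the strict
# transform of the leaf, in stalk language (`t′ = t/v ∈ 𝔪`, `v′ = v` a non-zero-divisor, `𝒪/(t,v) ≅ 𝒪′/(v′,t′)`, `𝒪′/(v′)` a localization of `K[X]`)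

Seat decomp-res-hand-2 g22 (structural hand); sequel of ✓ `…ChartStalk` (`exists_chart_localization_of_isBlowup`).  Along the σ-tower of memo 4e
§2.5 (hand-2 g21 blueprint, census (S2)) every level `j ≥ 1` blows up the curve `Z_{j−1} = V(t_j, v_j)` and reads the next point `z_{j+1}` on the strict
transform of the leaf; the general storey then specialises to EXACTLY the data ✓ `tower_face` / ✓ `leafOrder_tower` consume (`ψ_j t_j = v_{j+1} t_{j+1}`,
`ψ_j v_j = v_{j+1}`, `v_{j+1}` a non-zero-divisor) PLUS the chart identification:

* `stalkMap_mem_nonZeroDivisors_of_isBlowup` — the exceptional parameter `τ♯cᵢ` (any chart relations `τ♯c_k = τ♯cᵢ·uf_k`) is a NON-ZERO-DIVISOR of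
  `𝒪_{X′,x′}` (the exceptional divisor of a blowing up is effective Cartier: ✓ `IsEffectiveCartier.exists_stalkIdeal_eq_span` + ✓ `stalkIdeal_comap_eq_map`)
  — hypothesis `hvnzd` of ✓ `tower_face`.
* `uf_mem_maximalIdeal_of_mem_mul` — if `τ♯c_{i₀} ∈ (J𝒪′)·𝔪′` (the point lies on the strict transform of `V(c_{i₀})`, currency of
  ✓ `exists_chart_leafSum_step_of_isBlowup`) then the chart is not `i₀` and `uf_{i₀} ∈ 𝔪′`.
* `exists_sigmaStep_of_isBlowup` — **THE σ-STOREY** (`n = 2`, centre `(c 0, c 1) = (t, v)`, point on the strict transform of `V(t)`): `t′ ∈ 𝔪′` with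
  `τ♯t = τ♯v · t′`, `τ♯v` a non-zero-divisor, `𝒪′/(τ♯v)` and `𝒪′/(τ♯v, t′)` local, `𝒪_x/(t, v) → 𝒪′/(τ♯v, t′)` bijective (every class is a `τ♯r`;
  `τ♯r ∈ (τ♯v, t′) ⟹ r ∈ (t, v)`) with the `K`-localization invariant passing («`𝒪_{Z_j,z_{j+1}} ≅ 𝒪_{Z_{j−1},z_j}` is again the localization of `κ(c)[u]`»),
  and `𝒪′/(τ♯v)` (the exceptional divisor `E_{Z}` at `z′`) a localization of `K[X]` for every `K[X]`-structure with `C g ↦ class of g`, `X ↦ t′` — the input of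
  ✓ `isLocalizationAtPrime_span_pair_of_mem` (closed point of `Γ″`) / ✓ `exists_prime_isLocalizationAtPrime_span` (generic point), hence of
  ✓ `birth_descent_of_isLocalization` / ✓ `exists_successor_of_isLocalization`.

The level-`0` storey (point blow-up, `n = 3`: `𝒪_{Z_0,z_1}` is a localization of `κ(c)[u]`, `K = κ(c)`, `M₀ =` units) is ✓ `exists_chart_localization_of_isBlowup`
(X) with `J = {t}` verbatim.  What remains of (S2): chaining these storeys along the ℕ-indexed tower (census (S1)) and comparing with the cocone's `eval₂`
structure (✓ `isLocalization_of_algebraMap_eq`).  Honest framing: OURS, instantiation only; nothing here proves X44c, any case of `CleanModels`, or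
resolution of singularities in characteristic `p`. [cite: StacksProject, Tag 0804, Tag 0BIQ] [cite: CossartPiltant2008, Prop. 4.4 (proof, p. 11)]
[cite: CossartJannsenSaito2020, Lemma 7.5]
-/

noncomputable section

set_option linter.dupNamespace false -- mandated namespace of this single-conjunct summit

open IsLocalRing CategoryTheory AlgebraicGeometry
open Literature.AlgebraicGeometry.Resolution

namespace Summit.ResolutionOfSingularities.ResolutionOfSingularities.Theorems.RadicialJung.CleanModels

universe u

section Exceptional

variable {X X' : Scheme.{u}} {τ : X' ⟶ X} {J : X.IdealSheafData}

/-- The exceptional ideal `J·𝒪_{X′,x′}` is generated by `τ♯cᵢ` under the chart relations `τ♯c_k = τ♯cᵢ · uf_k`. [folklore] -/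
theorem map_stalkIdeal_eq_span_of_chart (x' : X') {n : ℕ} (c : Fin n → X.presheaf.stalk (τ x'))
    (hcJ : Ideal.span (Set.range c) = stalkIdeal J (τ x')) (i : Fin n) (uf : Fin n → X'.presheaf.stalk x')
    (hrel : ∀ k, (τ.stalkMap x').hom (c k) = (τ.stalkMap x').hom (c i) * uf k) :
    (stalkIdeal J (τ x')).map (τ.stalkMap x').hom = Ideal.span {(τ.stalkMap x').hom (c i)} := by
  rw [← hcJ, Ideal.map_span]
  apply le_antisymm
  · rw [Ideal.span_le]
    rintro _ ⟨_, ⟨k, rfl⟩, rfl⟩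
    rw [SetLike.mem_coe, hrel k]
    exact Ideal.mul_mem_right _ _ (Ideal.mem_span_singleton_self _)
  · rw [Ideal.span_singleton_le_iff_mem]
    exact Ideal.subset_span ⟨c i, ⟨i, rfl⟩, rfl⟩

/-- **The exceptional parameter is a non-zero-divisor**: for a blowing up `τ` along `J` with `(c) = J_x` and chart relations `τ♯c_k = τ♯cᵢ · uf_k`,
`τ♯cᵢ ∈ nonZeroDivisors 𝒪_{X′,x′}` (the exceptional divisor is effective Cartier) — hypothesis `hvnzd` of ✓ `tower_face`. [cite: StacksProject, Tag 0804] -/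
theorem stalkMap_mem_nonZeroDivisors_of_isBlowup (hτ : IsBlowup τ J) (x' : X') {n : ℕ} (c : Fin n → X.presheaf.stalk (τ x'))
    (hcJ : Ideal.span (Set.range c) = stalkIdeal J (τ x')) (i : Fin n) (uf : Fin n → X'.presheaf.stalk x')
    (hrel : ∀ k, (τ.stalkMap x').hom (c k) = (τ.stalkMap x').hom (c i) * uf k) :
    (τ.stalkMap x').hom (c i) ∈ nonZeroDivisors (X'.presheaf.stalk x') := by
  obtain ⟨s, hs, hseq⟩ := hτ.isEffectiveCartier.exists_stalkIdeal_eq_span x'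
  rw [stalkIdeal_comap_eq_map, map_stalkIdeal_eq_span_of_chart x' c hcJ i uf hrel] at hseq
  have hmem : s ∈ Ideal.span {(τ.stalkMap x').hom (c i)} := by rw [hseq]; exact Ideal.mem_span_singleton_self s
  obtain ⟨a, ha⟩ := Ideal.mem_span_singleton'.mp hmem
  rw [← ha] at hs
  exact (mul_mem_nonZeroDivisors.mp hs).2

/-- **On the strict transform of `V(c_{i₀})`**: if `τ♯c_{i₀} ∈ (J𝒪′)·𝔪′` and `J𝒪′ ≠ 0`, then under the chart relations the chart index is not `i₀` and
`uf_{i₀} ∈ 𝔪′` (otherwise `τ♯cᵢ ∈ (τ♯cᵢ)·𝔪′`, forcing `τ♯cᵢ = 0`). [folklore] -/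
theorem uf_mem_maximalIdeal_of_mem_mul (x' : X') {n : ℕ} (c : Fin n → X.presheaf.stalk (τ x'))
    (hcJ : Ideal.span (Set.range c) = stalkIdeal J (τ x')) (i : Fin n) (uf : Fin n → X'.presheaf.stalk x')
    (hrel : ∀ k, (τ.stalkMap x').hom (c k) = (τ.stalkMap x').hom (c i) * uf k) (i₀ : Fin n)
    (hL : (τ.stalkMap x').hom (c i₀) ∈ (stalkIdeal J (τ x')).map (τ.stalkMap x').hom * maximalIdeal (X'.presheaf.stalk x'))
    (hJ0 : (stalkIdeal J (τ x')).map (τ.stalkMap x').hom ≠ ⊥) :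
    i ≠ i₀ ∧ uf i₀ ∈ maximalIdeal (X'.presheaf.stalk x') := by
  have hexc := map_stalkIdeal_eq_span_of_chart x' c hcJ i uf hrel
  rw [hexc] at hL hJ0
  -- if `uf_{i₀}` were a unit, `τ♯cᵢ = τ♯c_{i₀} · uf_{i₀}⁻¹ ∈ (τ♯cᵢ)𝔪′`
  have key : uf i₀ ∈ maximalIdeal (X'.presheaf.stalk x') := by
    by_contra hu
    have hunit : IsUnit (uf i₀) := by
      by_contra h; exact hu ((IsLocalRing.mem_maximalIdeal _).mpr h)
    obtain ⟨v, hv⟩ := hunit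
    have h1 : (τ.stalkMap x').hom (c i) ∈ Ideal.span {(τ.stalkMap x').hom (c i)} * maximalIdeal (X'.presheaf.stalk x') := by
      have h := Ideal.mul_mem_right (↑v⁻¹ : X'.presheaf.stalk x') _ hL
      have heq : (τ.stalkMap x').hom (c i₀) * ↑v⁻¹ = (τ.stalkMap x').hom (c i) := by
        rw [hrel i₀, ← hv, mul_assoc, Units.mul_inv, mul_one]
      rwa [heq] at h
    obtain ⟨m, hm, hme⟩ := Ideal.mem_span_singleton_mul.mp h1
    have h2 : (τ.stalkMap x').hom (c i) * (1 - m) = 0 := by rw [mul_sub, mul_one, hme, sub_self]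
    have hu1 : IsUnit (1 - m) := IsLocalRing.isUnit_one_sub_self_of_mem_nonunits _ hm
    have he0 : (τ.stalkMap x').hom (c i) = 0 := by
      have := congrArg (· * hu1.unit⁻¹.val) h2
      simpa [mul_assoc] using this
    exact hJ0 (by rw [he0, Ideal.span_singleton_eq_bot])
  refine ⟨?_, key⟩
  rintro rfl
  -- `uf i = 1` under the relations? not needed: `τ♯cᵢ = τ♯cᵢ · uf_i` with `uf_i ∈ 𝔪′` gives `τ♯cᵢ (1 - uf_i) = 0`
  have h2 : (τ.stalkMap x').hom (c i) * (1 - uf i) = 0 := by rw [mul_sub, mul_one, ← hrel i, sub_self]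
  have hu1 : IsUnit (1 - uf i) := IsLocalRing.isUnit_one_sub_self_of_mem_nonunits _ key
  have he0 : (τ.stalkMap x').hom (c i) = 0 := by
    have := congrArg (· * hu1.unit⁻¹.val) h2
    simpa [mul_assoc] using this
  exact hJ0 (by rw [he0, Ideal.span_singleton_eq_bot])

end Exceptional

/-! ## The σ-storey: `n = 2`, centre `(t, v) = (c 0, c 1)`, the point on the strict transform of `V(t)` -/

section SigmaStep

variable {X X' : Scheme.{u}} {τ : X' ⟶ X} {J : X.IdealSheafData}

/-- The image of the one-element index type `{j : Fin 2 // j ≠ 1}`. [folklore] -/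
theorem image_univ_fin_two_ne_one {α : Type*} (f : {j : Fin 2 // j ≠ 1} → α) :
    f '' Set.univ = {f ⟨0, by decide⟩} := by
  ext a
  simp only [Set.image_univ, Set.mem_range, Set.mem_singleton_iff]
  constructor
  · rintro ⟨⟨j, hj⟩, rfl⟩
    have : j = 0 := by
      rcases Fin.exists_fin_two.mp ⟨j, rfl⟩ with h | h
      · exact h
      · exact absurd h hj
    subst this
    rfl
  · rintro rfl
    exact ⟨⟨0, by decide⟩, rfl⟩

set_option maxHeartbeats 400000 in
-- the statement is long; elaboration of the seven conjuncts
/-- **THE σ-STOREY** (see the module docstring).  Centre `Z = V(c 0, c 1)` through `x = τ x′`, `(c, w)` a regular system of parameters of `𝒪_{X,x}`,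
`(c) = J_x`, and `x′` on the strict transform of `V(c 0)` (`τ♯(c 0) ∈ (J𝒪′)·𝔪′`, `J𝒪′ ≠ 0`). [cite: StacksProject, Tag 0804, Tag 0BIQ]
[cite: CossartPiltant2008, Prop. 4.4 (proof, p. 11)] -/
theorem exists_sigmaStep_of_isBlowup (hτ : IsBlowup τ J) (x' : X') (hR : IsRegularLocalRing (X.presheaf.stalk (τ x'))) {l : ℕ}
    (c : Fin 2 → X.presheaf.stalk (τ x')) (w : Fin l → X.presheaf.stalk (τ x'))
    (hz : Ideal.span (Set.range (Fin.append c w)) = maximalIdeal (X.presheaf.stalk (τ x')))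
    (hdim : ringKrullDim (X.presheaf.stalk (τ x')) = ((2 + l : ℕ) : WithBot ℕ∞))
    (hcJ : Ideal.span (Set.range c) = stalkIdeal J (τ x'))
    (hL : (τ.stalkMap x').hom (c 0) ∈ (stalkIdeal J (τ x')).map (τ.stalkMap x').hom * maximalIdeal (X'.presheaf.stalk x'))
    (hJ0 : (stalkIdeal J (τ x')).map (τ.stalkMap x').hom ≠ ⊥) :
    ∃ t' : X'.presheaf.stalk x',
      (τ.stalkMap x').hom (c 0) = (τ.stalkMap x').hom (c 1) * t' ∧ t' ∈ maximalIdeal (X'.presheaf.stalk x') ∧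
      (τ.stalkMap x').hom (c 1) ∈ nonZeroDivisors (X'.presheaf.stalk x') ∧
      IsLocalRing (X'.presheaf.stalk x' ⧸ Ideal.span {(τ.stalkMap x').hom (c 1)}) ∧
      IsLocalRing (X'.presheaf.stalk x' ⧸ Ideal.span {(τ.stalkMap x').hom (c 1), t'}) ∧
      -- (Z) `𝒪_x/(t, v) ≅ 𝒪′/(τ♯v, t′)` and the `K`-localization invariant
      ((∀ q : X'.presheaf.stalk x' ⧸ Ideal.span {(τ.stalkMap x').hom (c 1), t'},
          ∃ r, Ideal.Quotient.mk _ ((τ.stalkMap x').hom r) = q) ∧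
        (∀ r, (τ.stalkMap x').hom r ∈ Ideal.span {(τ.stalkMap x').hom (c 1), t'} → r ∈ Ideal.span (Set.range c)) ∧
        (∀ (K : Type u) [CommRing K] [Algebra K (X.presheaf.stalk (τ x') ⧸ Ideal.span (Set.range c))] (M₀ : Submonoid K)
          [IsLocalization M₀ (X.presheaf.stalk (τ x') ⧸ Ideal.span (Set.range c))]
          (inst : Algebra K (X'.presheaf.stalk x' ⧸ Ideal.span {(τ.stalkMap x').hom (c 1), t'})),
          (∀ (g : K) (r : X.presheaf.stalk (τ x')), Ideal.Quotient.mk _ r = algebraMap K (X.presheaf.stalk (τ x') ⧸ Ideal.span (Set.range c)) g →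
            algebraMap K (X'.presheaf.stalk x' ⧸ Ideal.span {(τ.stalkMap x').hom (c 1), t'}) g = Ideal.Quotient.mk _ ((τ.stalkMap x').hom r)) →
          IsLocalization M₀ (X'.presheaf.stalk x' ⧸ Ideal.span {(τ.stalkMap x').hom (c 1), t'}))) ∧
      -- (E) the exceptional divisor `𝒪′/(τ♯v)` is a localization of `K[X]`, `X ↦ t′`
      (∀ (K : Type u) [CommRing K] [Algebra K (X.presheaf.stalk (τ x') ⧸ Ideal.span (Set.range c))] (M₀ : Submonoid K)
        [IsLocalization M₀ (X.presheaf.stalk (τ x') ⧸ Ideal.span (Set.range c))]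
        (inst : Algebra (Polynomial K) (X'.presheaf.stalk x' ⧸ Ideal.span {(τ.stalkMap x').hom (c 1)})),
        (∀ (g : K) (r : X.presheaf.stalk (τ x')), Ideal.Quotient.mk _ r = algebraMap K (X.presheaf.stalk (τ x') ⧸ Ideal.span (Set.range c)) g →
          algebraMap (Polynomial K) (X'.presheaf.stalk x' ⧸ Ideal.span {(τ.stalkMap x').hom (c 1)}) (Polynomial.C g) =
            Ideal.Quotient.mk _ ((τ.stalkMap x').hom r)) →
        algebraMap (Polynomial K) (X'.presheaf.stalk x' ⧸ Ideal.span {(τ.stalkMap x').hom (c 1)}) Polynomial.X = Ideal.Quotient.mk _ t' →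
        ∃ N : Submonoid (Polynomial K), IsLocalization N (X'.presheaf.stalk x' ⧸ Ideal.span {(τ.stalkMap x').hom (c 1)})) := by
  obtain ⟨i, uf, hrel, -, hloc, hZ, hX⟩ := exists_chart_localization_of_isBlowup hτ x' hR c w hz hdim hcJ
  obtain ⟨hi0, ht'⟩ := uf_mem_maximalIdeal_of_mem_mul x' c hcJ i uf hrel 0 hL hJ0
  -- the chart is the `v`-chart
  obtain rfl : i = 1 := by
    rcases Fin.exists_fin_two.mp ⟨i, rfl⟩ with h | h
    · exact absurd h hi0
    · exact h
  have hnzd := stalkMap_mem_nonZeroDivisors_of_isBlowup hτ x' c hcJ 1 uf hrel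
  -- the two chart ideals in the shape of ✓ `exists_chart_localization_of_isBlowup`
  have hE : Ideal.span {(τ.stalkMap x').hom (c 1)} =
      Ideal.span {(τ.stalkMap x').hom (c 1)} ⊔ Ideal.span ((fun j : {j : Fin 2 // j ≠ 1} => uf j.1) '' ∅) := by
    rw [Set.image_empty, Ideal.span_empty, sup_bot_eq]
  have hZ' : Ideal.span {(τ.stalkMap x').hom (c 1), uf 0} =
      Ideal.span {(τ.stalkMap x').hom (c 1)} ⊔ Ideal.span ((fun j : {j : Fin 2 // j ≠ 1} => uf j.1) '' Set.univ) := by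
    rw [image_univ_fin_two_ne_one, Ideal.span_insert]
  have hall : ∀ j : {j : Fin 2 // j ≠ 1}, uf j.1 ∈ maximalIdeal (X'.presheaf.stalk x') := by
    rintro ⟨j, hj⟩
    have : j = 0 := by
      rcases Fin.exists_fin_two.mp ⟨j, rfl⟩ with h | h
      · exact h
      · exact absurd h hj
    subst this
    exact ht'
  obtain ⟨hsurj, hinj, hKloc⟩ := hZ _ hZ' hall
  refine ⟨uf 0, hrel 0, ht', hnzd, hloc ∅ _ hE (fun j hj => absurd hj (Set.notMem_empty j)), hloc Set.univ _ hZ' (fun j _ => hall j),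
    ⟨hsurj, hinj, hKloc⟩, fun K _ _ M₀ _ inst hKC hKX => ?_⟩
  exact hX ∅ _ hE ⟨0, by decide⟩ (Set.notMem_empty _) (fun j _ => by
      obtain ⟨j, hj⟩ := j
      have : j = 0 := by
        rcases Fin.exists_fin_two.mp ⟨j, rfl⟩ with h | h
        · exact h
        · exact absurd h hj
      subst this; rfl)
    K M₀ inst hKC hKX

end SigmaStep

end Summit.ResolutionOfSingularities.ResolutionOfSingularities.Theorems.RadicialJung.CleanModels

end
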